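import Literature.NumberTheory.Automorphic.BockleHuiIrreducibleGL3Proofs
import Literature.NumberTheory.Automorphic.ClozelAlgebraicity
import Literature.NumberTheory.Automorphic.SatakeParamNeZeroProofs
import Literature.NumberTheory.GaloisRepresentations.WeakAbelianDirectSummandCyclotomicProofs
import Literature.NumberTheory.GaloisRepresentations.WeakAbelianDirectSummandTwistProofs
import HarnessLib

/-!
# Böckle–Hui 2025, Theorem 1.2 — reduction of the printed proof (§3.1–§3.2.1) to its
# automorphic core: `E`-rationality from C-arithmeticity, and the `L`-function dichotomy at
# Satake level

Topic `NumberTheory/Automorphic`; namespaces `Literature.NumberTheory.GaloisRepresentations`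
(bookkeeping on Hecke characters and rank-one framed representations) and
`Literature.NumberTheory.Automorphic`.  Second PROOFS file (theorems only: no definition, no named
fact, no `sorry`) next to `BockleHuiIrreducibleGL3Proofs.lean`, for the named fact
`isIrreducible_galoisRep_gl3_totallyReal` (Böckle–Hui, Math. Ann. 393 (2025), Thm. 1.2 =
"Theorem (main)", arXiv:2404.08954, p. 13), which is NOT discharged here.  The first proofs file
assembled the theorem from four inputs stated as hypotheses: Böckle–Hui's Thm. 1.1 (the in-tree
named fact `GaloisRepresentations.exists_heckeCharacter_of_weaklyDivides`), the `E`-rationality of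
`ρ_{π,ι}` (`hrat`), the `L`-function dichotomy (`hL`) and [Hu23a] (`hHui`).  This file proves two
further steps of the printed proof, so that `hrat` and `hL` are replaced by statements about `π`
ALONE — the Galois representation is eliminated from both:

* **§3.1, `E`-rationality from C-arithmeticity** (`isRationalOver_of_heckeEigenvalue_mem_three`,
  `rational_gl3_totallyReal_of_heckeEigenvalue_mem`).  Source (p. 13): "By Clozel [Cl90], `π` is
  C-arithmetic. By [BG14], `π` is C-arithmetic if and only if `π ⊗ |det|^{(1-n)/2}` is
  L-arithmetic. Thus, there exist a number field `E` and a finite subset `S ⊂ Σ_K` containing the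
  ramified primes of `π` such that the Satake parameters of `π_v ⊗ |det|_v^{(1-n)/2}` are defined
  over `E` for all `v ∈ Σ_K ∖ S`. … Then the semisimple `ℓ`-adic representation … `ρ_{π,ι}` … is
  `E`-rational and unramified outside `S`."  Proved here for `n = 3`: if the unramified Hecke
  eigenvalues `t_{v,i} = q_v^{i(3-i)/2} e_i(α_v)` (`heckeEigenvalueOf`, VERBATIM the eigenvalues of
  `AutomorphicRepData.HasSatakeParamAt`) lie in a subfield `E ⊆ ℂ` at almost all `v`, then every
  `r` with the unramified compatibility of lang.S27 is `E`-rational for `ι⁻¹|_E` (its Frobenius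
  polynomial at a good place is `X³ - (e₂/(q e₃)) X² + (e₁/(q² e₃)) X - 1/(q³ e₃)` with
  `e_i = e_i(α_v) ∈ E`, `e₃ ≠ 0` because Satake parameters are non-zero,
  `hasSatakeParamAt_ne_zero_holds`).  The rank-two analogue is
  `isRationalOver_of_heckeEigenvalue_mem_two` of `HilbertModularGaloisRepProofs`.
* **§3.2.1, from `ρ_λ = σ_λ ⊕ τ_λ` and (lg) to the automorphic side**
  (`exists_mem_satake_valueAtUniformizer_eq_of_stableLine`,
  `exists_algebraic_valueAtUniformizer_mem_satake_of_stableLine`): if `τ` is the character on an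
  `r`-stable line and `χ` the algebraic Hecke character of `τ` given by Thm. 1.1
  (`τ(Frob_v) = ι⁻¹(χ(ϖ_v))⁻¹` a.e.), then the algebraic Hecke character `μ = χ‖·‖` has
  `μ(ϖ_v) ∈ α_v` (one of the three Satake eigenvalues of `π_v`) at almost every `v`.  This is what
  "(Alt) and the local-global compatibility (lg)" feed into the `L`-function identity (L-eq): after
  it, the argument of §3.2.1 concerns only `π`, `μ` and automorphic `L`-functions.
* **§3.2.1, the case "`det(σ_λ)·τ_λ^{-2}` is trivial"** (`map_inv_eq_map_mul_of_prod_eq_cube`,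
  `exists_essSelfDual_satake_of_prod_eq_cube`): at Satake level this case reads `∏ α_v = μ(ϖ_v)³`
  a.e., and then `{a⁻¹ : a ∈ α_v} = {μ(ϖ_v)⁻² a : a ∈ α_v}` a.e. — `π` is essentially self-dual at
  Satake level with `η = μ⁻²` ("Then `ρ_λ ⊗ τ_λ^{-1}` is self-dual. … `π` is essentially self-dual";
  read eigenvalue by eigenvalue, so multiplicity one [JS81] is not needed for this rendering).
* **Assembly** (`lDichotomy_gl3_totallyReal_of_satakeLevel`,
  `isIrreducible_galoisRep_gl3_totallyReal_of_weaklyDivides_of_arithmetic_of_satakeLevel_of_hui`):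
  the hypothesis `hL` of `reducible_forces_essSelfDual_gl3_totallyReal_of` follows from the
  remaining analytic case of §3.2.1 stated about `π` alone (`hB`: "Suppose `det(σ_λ)·τ_λ^{-2}` is
  non-trivial. … We get a contradiction", i.e. an algebraic Hecke character `μ` with `μ(ϖ_v) ∈ α_v`
  a.e. forces `∏ α_v = μ(ϖ_v)³` a.e.), and the named fact follows from `exists_heckeCharacter_of_weaklyDivides`,
  C-arithmeticity of `π` (`hCar`), `hB` and [Hu23a] (`hHui`).

## Status of the remaining inputs (why the fact is still not discharged)

* `hBH` = `GaloisRepresentations.exists_heckeCharacter_of_weaklyDivides` (BH Thm. 1.1): in-tree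
  named fact, unproved.
* `hCar` (C-arithmeticity of regular algebraic cuspidal `π` on `GL_3`: Clozel 1990, Thm. 3.13 with
  Buzzard–Gee 2014; the sentence of §3.1 quoted above): not in the tree — the in-tree fact
  `Clozel1990_regularAlgebraic` renders `ℚ(π_f)` as the fixed field of the a.e.-stabiliser of the
  eigensystem, which does not assert `t_{v,i} ∈ E` off ONE finite set `S`.
* `hB` (the analytic case): by the Euler-factor identity
  `L^S(s, π₀ × θ⁻¹) L^S(s, ν) = ζ_K^S(s) L^S(s, (π₀^∨ ⊗ ω₀θ⁻²) × 1)` (`π₀`, `θ` the unitary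
  normalisations of `π`, `μ`; `ν = ω₀ θ⁻³`; for `n = 3`, `Alt² = (·)^∨ ⊗ det`, so neither [Sh97] nor
  exterior-square functoriality is needed) it reduces to Jacquet–Shalika (Arthur–Clozel (2.1)–(2.3),
  in the tree as the named facts `JacquetShalika1981_*_repData` of `PairLFunctionPolesRepData`) plus
  the weight bookkeeping placing `s = 1` at the edge of the critical strip (Clozel purity; `K`
  totally real and `n = 3` odd).  Not done here.
* `hHui` ([Hu23a], J. Lond. Math. Soc. 108 (2023), Thm. 1.4, §4.4): absent from the tree.

## References

* G. Böckle, C.-Y. Hui, *Weak abelian direct summands and irreducibility of Galois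
  representations*, Math. Ann. 393 (2025) 543–569, Thm. 1.1, Thm. 1.2, §3.1, §3.2.1 (arXiv
  p. 13). [BockleHui2025]
* L. Clozel, *Motifs et formes automorphes*, in: Automorphic forms, Shimura varieties, and
  L-functions I (1990), Thm. 3.13. [Clozel1990]
* K. Buzzard, T. Gee, *The conjectural connections between automorphic representations and Galois
  representations*, LMS Lecture Notes 414 (2014), §2.1, Lemma 5.3.1 (C- vs L-arithmetic).
  [BuzzardGeeLMS2014]
* H. Jacquet, J. Shalika, *On Euler products and the classification of automorphic forms I, II*,
  Amer. J. Math. 103 (1981). [JacquetShalikaAJM1981] [JacquetShalikaAJM1981II]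
* C.-Y. Hui, *Monodromy of subrepresentations and irreducibility of low degree automorphic Galois
  representations*, J. Lond. Math. Soc. 108 (2023), Thm. 1.4, §4.4.
-/

noncomputable section

open scoped NumberField Matrix Polynomial Classical
open NumberField IsDedekindDomain Field Polynomial Filter

namespace Literature.NumberTheory.GaloisRepresentations

/-! ### Bookkeeping: Hecke characters at uniformizers, rank-one characteristic polynomials
(private copies of local helpers; cf. `HeckeLFunctionAnalyticProofs`, `ArtinLFunctionDirichletProofs`) -/

namespace HeckeCharacter

variable {K : Type} [Field K] [NumberField K]

/-- `(χ ψ)(ϖ_v) = χ(ϖ_v) ψ(ϖ_v)`. [folklore] -/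
private theorem valueAtUniformizer_mul_bh (χ ψ : HeckeCharacter K) (v : HeightOneSpectrum (𝓞 K)) :
    (χ * ψ).valueAtUniformizer v = χ.valueAtUniformizer v * ψ.valueAtUniformizer v := by
  simp only [valueAtUniformizer, localComponent_apply, mul_apply, Units.val_mul]

/-- `χ(ϖ_v) ≠ 0` (a value of a character into `ℂˣ`). [folklore] -/
private theorem valueAtUniformizer_ne_zero_bh (χ : HeckeCharacter K) (v : HeightOneSpectrum (𝓞 K)) :
    χ.valueAtUniformizer v ≠ 0 :=
  Units.ne_zero _

/-- A product of characters unramified at `v` is unramified at `v`. [folklore] -/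
private theorem IsUnramifiedAt.mul_bh {χ ψ : HeckeCharacter K} {v : HeightOneSpectrum (𝓞 K)}
    (hχ : χ.IsUnramifiedAt v) (hψ : ψ.IsUnramifiedAt v) : (χ * ψ).IsUnramifiedAt v := by
  intro u
  have h1 := hχ u
  have h2 := hψ u
  simp only [localComponent_apply, mul_apply] at h1 h2 ⊢
  rw [h1, h2, mul_one]

/-- The inverse of a character unramified at `v` is unramified at `v`. [folklore] -/
private theorem IsUnramifiedAt.inv_bh {χ : HeckeCharacter K} {v : HeightOneSpectrum (𝓞 K)}
    (hχ : χ.IsUnramifiedAt v) : χ⁻¹.IsUnramifiedAt v := by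
  intro u
  have h1 := hχ u
  simp only [localComponent_apply, inv_apply] at h1 ⊢
  rw [h1, inv_one]

end HeckeCharacter

/-- For a framed representation of rank one, `charpoly (τ g) = X - det (τ g)`
(Mathlib `Matrix.det_fin_one`, `Matrix.charmatrix_apply_eq`). [folklore] -/
private theorem FramedRep.charpoly_eq_X_sub_C_det_of_rank_one_bh {G A : Type*} [Group G]
    [TopologicalSpace G] [CommRing A] [TopologicalSpace A] (τ : FramedRep G A 1) (g : G) :
    FramedRep.charpoly τ g = X - C ((Matrix.GeneralLinearGroup.det (τ g) : Aˣ) : A) := by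
  rw [FramedRep.charpoly, Matrix.charpoly, Matrix.det_fin_one, Matrix.charmatrix_apply_eq,
    Matrix.GeneralLinearGroup.val_det_apply, Matrix.det_fin_one]

end Literature.NumberTheory.GaloisRepresentations

namespace Literature.NumberTheory.Automorphic

open GaloisRepresentations

/-! ### Elementary symmetric functions of a triple -/

section Triple

/-- `e₁{a, b, c} = a + b + c`. [folklore] -/
theorem esymm_one_triple (a b c : ℂ) : ({a, b, c} : Multiset ℂ).esymm 1 = a + b + c := by
  simp [Multiset.esymm, Multiset.powersetCard_one, Multiset.insert_eq_cons]
  ring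

/-- `e₂{a, b, c} = ab + ac + bc`. [folklore] -/
theorem esymm_two_triple (a b c : ℂ) :
    ({a, b, c} : Multiset ℂ).esymm 2 = a * b + a * c + b * c := by
  simp [Multiset.esymm, Multiset.powersetCard_one, Multiset.insert_eq_cons,
    Multiset.powersetCard_cons]
  ring

/-- `e₃{a, b, c} = abc`. [folklore] -/
theorem esymm_three_triple (a b c : ℂ) : ({a, b, c} : Multiset ℂ).esymm 3 = a * b * c := by
  simp [Multiset.esymm, Multiset.powersetCard_one, Multiset.insert_eq_cons,
    Multiset.powersetCard_cons]
  ring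

end Triple

/-! ### BH §3.1 for `n = 3`: `E`-rationality of compatible `r` from C-arithmeticity of `π` -/

section Rational

variable {K : Type} [Field K] [NumberField K] {hcpt : isCompact_glFiniteIntegralLevel 3 K}
  {ℓ : ℕ} [Fact ℓ.Prime]

/-- The places above `ℓ` are finitely many (Mathlib `Ideal.finite_factors`). [folklore] -/
private theorem eventually_natCast_notMem_asIdeal₃ (K : Type) [Field K] [NumberField K] (ℓ : ℕ)
    [Fact ℓ.Prime] : ∀ᶠ v : HeightOneSpectrum (𝓞 K) in cofinite, ((ℓ : ℕ) : 𝓞 K) ∉ v.asIdeal := by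
  have hne : Ideal.span {((ℓ : ℕ) : 𝓞 K)} ≠ ⊥ := by
    rw [Ne, Ideal.span_singleton_eq_bot]
    exact_mod_cast (Fact.out : ℓ.Prime).ne_zero
  refine Filter.mem_of_superset (Ideal.finite_factors hne).compl_mem_cofinite ?_
  intro v hv hmem
  exact hv (Ideal.dvd_span_singleton.2 hmem)

/-- **`E`-rationality of a compatible rank-three `r` from the rationality of the unramified Hecke
eigenvalues** (Böckle–Hui §3.1: "there exist a number field `E` and a finite subset `S ⊂ Σ_K`
containing the ramified primes of `π` such that the Satake parameters of
`π_v ⊗ |det|_v^{(1-n)/2}` are defined over `E` for all `v ∈ Σ_K ∖ S`. … Then the semisimple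
`ℓ`-adic representation … `ρ_{π,ι}` … is `E`-rational and unramified outside `S`").  Rank three:
if at all but finitely many places the Hecke eigenvalues `t_{v,1} = q_v e₁(α)`, `t_{v,2} = q_v e₂(α)`,
`t_{v,3} = e₃(α)` of `π` (`heckeEigenvalueOf 3 v α i`, the eigenvalues of
`AutomorphicRepData.HasSatakeParamAt`) lie in the subfield `E ⊆ ℂ`, then every `r` with the
unramified compatibility of lang.S27 is `E`-rational for `ι⁻¹|_E : E → ℚ̄_ℓ`: with `α = {a, b, c}`
(all non-zero, `hasSatakeParamAt_ne_zero_holds`) its Frobenius characteristic polynomial at a good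
place is `∏ (X - ι⁻¹((q a)⁻¹)) = X³ - ι⁻¹(e₂/(q e₃)) X² + ι⁻¹(e₁/(q² e₃)) X - ι⁻¹(1/(q³ e₃))`, a
polynomial over `ι⁻¹(E)`.  The good places are cofinite by Flath
(`AutomorphicRepData.hasSatakeParamAt_cofinite_holds`) and the finiteness of the places above `ℓ`.
[cite: BockleHui2025, §3.1] -/
theorem isRationalOver_of_heckeEigenvalue_mem_three
    (π : AutomorphicRepData (AutomorphyDatum.gl 3 K hcpt)) (ι : PadicAlgCl ℓ ≃+* ℂ)
    (r : FramedGaloisRep K (PadicAlgCl ℓ) 3)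
    (hr : ∀ (v : HeightOneSpectrum (𝓞 K)) (α : Multiset ℂ), π.HasSatakeParamAt v α →
      ((ℓ : ℕ) : 𝓞 K) ∉ v.asIdeal →
        r.IsUnramifiedAt v ∧ r.HasFrobCharpolyAt v (arithFrobPolyOfSatake ι v.residueCard 3 α))
    (E : Subfield ℂ)
    (hE : ∀ᶠ v : HeightOneSpectrum (𝓞 K) in cofinite, ∀ α : Multiset ℂ,
      π.HasSatakeParamAt v α → ∀ i ≤ 3, heckeEigenvalueOf 3 v α i ∈ E) :
    r.IsRationalOver ((ι.symm : ℂ ≃+* PadicAlgCl ℓ).toRingHom.comp E.subtype) := by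
  have hcof : ∀ᶠ v : HeightOneSpectrum (𝓞 K) in cofinite, π.IsUnramifiedAt v :=
    π.hasSatakeParamAt_cofinite_holds
  filter_upwards [hcof, hE, eventually_natCast_notMem_asIdeal₃ K ℓ] with v hv hEv hvℓ
  obtain ⟨α, hα⟩ := hv
  obtain ⟨hunr, hP⟩ := hr v α hα hvℓ
  refine ⟨hunr, ?_⟩
  have hne : ∀ a ∈ α, a ≠ 0 := hasSatakeParamAt_ne_zero_holds hα
  have ht1 := hEv _ hα 1 (by norm_num)
  have ht2 := hEv _ hα 2 (by norm_num)
  have ht3 := hEv _ hα 3 le_rfl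
  obtain ⟨a, b, c, rfl⟩ := Multiset.card_eq_three.1 hα.card_eq
  have ha : a ≠ 0 := hne a (by simp)
  have hb : b ≠ 0 := hne b (by simp)
  have hc : c ≠ 0 := hne c (by simp)
  rw [heckeEigenvalueOf, esymm_one_triple] at ht1
  rw [heckeEigenvalueOf, esymm_two_triple] at ht2
  rw [heckeEigenvalueOf, esymm_three_triple] at ht3
  norm_num at ht1 ht2 ht3
  -- `√q`
  set q : ℕ := v.residueCard with hq
  set sq : ℂ := ((Real.sqrt (q : ℝ) : ℝ) : ℂ) with hsq
  have hsq2 : sq ^ 2 = (q : ℂ) := by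
    rw [hsq, ← Complex.ofReal_pow, Real.sq_sqrt (Nat.cast_nonneg _), Complex.ofReal_natCast]
  have hsq0 : sq ≠ 0 := by
    rw [hsq, Complex.ofReal_ne_zero]
    exact Real.sqrt_ne_zero'.2 (by exact_mod_cast lt_trans zero_lt_one v.one_lt_residueCard)
  have hqE : sq ^ 2 ∈ E := by rw [hsq2]; exact natCast_mem E q
  -- `e₁, e₂ ∈ E` (and `e₃ ∈ E` is `ht3`)
  have he1 : a + b + c ∈ E := by
    have h := mul_mem (inv_mem hqE) ht1
    rwa [inv_mul_cancel_left₀ (pow_ne_zero 2 hsq0)] at h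
  have he2 : a * b + a * c + b * c ∈ E := by
    have h := mul_mem (inv_mem hqE) ht2
    rwa [inv_mul_cancel_left₀ (pow_ne_zero 2 hsq0)] at h
  -- the inverse roots `u = (q a)⁻¹`, `w = (q b)⁻¹`, `z = (q c)⁻¹` and their symmetric functions
  set u : ℂ := (sq ^ 2 * a)⁻¹ with hu
  set w : ℂ := (sq ^ 2 * b)⁻¹ with hw
  set z : ℂ := (sq ^ 2 * c)⁻¹ with hz
  have hS1 : u + w + z ∈ E := by
    have e : u + w + z = (a * b + a * c + b * c) * (sq ^ 2 * (a * b * c))⁻¹ := by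
      rw [hu, hw, hz]
      field_simp
      ring
    rw [e]
    exact mul_mem he2 (inv_mem (mul_mem hqE ht3))
  have hS2 : u * w + u * z + w * z ∈ E := by
    have e : u * w + u * z + w * z = (a + b + c) * (sq ^ 2 * sq ^ 2 * (a * b * c))⁻¹ := by
      rw [hu, hw, hz]
      field_simp
      ring
    rw [e]
    exact mul_mem he1 (inv_mem (mul_mem (mul_mem hqE hqE) ht3))
  have hS3 : u * w * z ∈ E := by
    have e : u * w * z = (sq ^ 2 * sq ^ 2 * sq ^ 2 * (a * b * c))⁻¹ := by
      rw [hu, hw, hz]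
      field_simp
    rw [e]
    exact inv_mem (mul_mem (mul_mem (mul_mem hqE hqE) hqE) ht3)
  refine ⟨X ^ 3 - C (⟨u + w + z, hS1⟩ : E) * X ^ 2 + C (⟨u * w + u * z + w * z, hS2⟩ : E) * X -
    C (⟨u * w * z, hS3⟩ : E), ?_⟩
  intro 𝔓 h𝔓 σ hσ
  rw [hP 𝔓 h𝔓 σ hσ]
  simp only [arithFrobPolyOfSatake, Multiset.insert_eq_cons, Multiset.map_cons,
    Multiset.map_singleton, Multiset.prod_cons, Multiset.prod_singleton, Polynomial.map_add,
    Polynomial.map_sub, Polynomial.map_mul, Polynomial.map_pow, map_X, map_C,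
    RingHom.coe_comp, Function.comp_apply, RingEquiv.toRingHom_eq_coe, RingEquiv.coe_toRingHom,
    Subfield.coe_subtype, map_add, map_mul]
  have h31 : (3 - 1 : ℕ) = 2 := rfl
  rw [h31, ← hsq, ← hu, ← hw, ← hz]
  ring

/-- **The `E`-rationality input `hrat` of `reducible_forces_essSelfDual_gl3_totallyReal_of` from
C-arithmeticity.**  If every regular algebraic cuspidal `π` on `GL_3(𝔸_K)` over a totally real `K`
is C-arithmetic in the sense of BH §3.1 — a number field `E ⊆ ℂ` contains the unramified Hecke
eigenvalues `t_{v,i}` at all but finitely many places ("the Satake parameters of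
`π_v ⊗ |det|_v^{-1}` are defined over `E` for all `v ∉ S`"; Clozel 1990, Thm. 3.13, with
Buzzard–Gee) — then every `r` compatible with such a `π` is `E`-rational for a number field `E`,
by `isRationalOver_of_heckeEigenvalue_mem_three`. [cite: BockleHui2025, §3.1]
[cite: Clozel1990, Thm. 3.13] -/
theorem rational_gl3_totallyReal_of_heckeEigenvalue_mem
    (hCar : ∀ {K : Type} [Field K] [NumberField K] (hcpt : isCompact_glFiniteIntegralLevel 3 K),
      IsTotallyReal K → ∀ (π : CuspidalAutomorphicRepData 3 K hcpt), π.1.IsRegularAlgebraic →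
      ∃ E : Subfield ℂ, FiniteDimensional ℚ E ∧
        ∀ᶠ v : HeightOneSpectrum (𝓞 K) in cofinite, ∀ α : Multiset ℂ,
          π.1.HasSatakeParamAt v α → ∀ i ≤ 3, heckeEigenvalueOf 3 v α i ∈ E) :
    ∀ (K : Type) [Field K] [NumberField K], IsTotallyReal K →
      ∀ (hcpt : isCompact_glFiniteIntegralLevel 3 K) (π : CuspidalAutomorphicRepData 3 K hcpt),
        π.1.IsRegularAlgebraic → ∀ (ℓ : ℕ) [Fact ℓ.Prime] (ι : PadicAlgCl ℓ ≃+* ℂ)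
        (r : FramedGaloisRep K (PadicAlgCl ℓ) 3), r.toGaloisRep.IsSemisimple →
        (∀ (v : HeightOneSpectrum (𝓞 K)) (α : Multiset ℂ), π.1.HasSatakeParamAt v α →
            ((ℓ : ℕ) : 𝓞 K) ∉ v.asIdeal →
              r.IsUnramifiedAt v ∧ r.HasFrobCharpolyAt v (arithFrobPolyOfSatake ι v.residueCard 3 α)) →
        ∃ (E : Type) (_ : Field E) (_ : NumberField E) (e : E →+* PadicAlgCl ℓ), r.IsRationalOver e := by
  intro K _ _ hK hcpt π hπ ℓ _ ι r _ hr
  obtain ⟨E, hfd, hE⟩ := hCar hcpt hK π hπ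
  haveI : FiniteDimensional ℚ E := hfd
  haveI : NumberField E := NumberField.mk
  exact ⟨E, inferInstance, inferInstance, _, isRationalOver_of_heckeEigenvalue_mem_three π.1 ι r hr E hE⟩

end Rational

/-! ### BH §3.2.1: from `ρ_λ = σ_λ ⊕ τ_λ` and (lg) to a Hecke character among the Satake
eigenvalues -/

section StableLineHecke

variable {K : Type} [Field K] [NumberField K] {n : ℕ} {hcpt : isCompact_glFiniteIntegralLevel n K}
  {ℓ : ℕ} [Fact ℓ.Prime]

/-- **The Hecke character of the stable line, read at Satake level.**  If `r` has the unramified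
compatibility of lang.S27 with `π`, `τ` is the character on an `r`-stable line, and at the place
`v ∤ ℓ` (where `π` has Satake parameter `α`) one has `τ(Frob_v) = ι⁻¹(χ(ϖ_v))⁻¹`
(`τ.HasFrobCharpolyAt v (X - C (ι⁻¹(χ(ϖ_v))⁻¹))`, the conclusion of BH Thm. 1.1), then
`χ(ϖ_v) = q_v^{(n-1)/2} a` for some `a ∈ α`: both numbers are `ι(τ(Frob_v))⁻¹`
(`stableLine_isUnramifiedAt_and_det_eq`; a Frobenius at `v` exists,
`HeightOneSpectrum.exists_isArithFrobAt_of_mem_primesAbove_holds`).  This is how (lg) turns the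
identity of Galois representations `ρ_λ = σ_λ ⊕ τ_λ` into a statement about `π` and the Hecke
character `τ` in BH §3.2.1. [cite: BockleHui2025, §3.2.1] -/
theorem exists_mem_satake_valueAtUniformizer_eq_of_stableLine
    (π : AutomorphicRepData (AutomorphyDatum.gl n K hcpt)) (ι : PadicAlgCl ℓ ≃+* ℂ)
    (r : FramedGaloisRep K (PadicAlgCl ℓ) n)
    (hr : ∀ (v : HeightOneSpectrum (𝓞 K)) (α : Multiset ℂ), π.HasSatakeParamAt v α →
      ((ℓ : ℕ) : 𝓞 K) ∉ v.asIdeal →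
        r.IsUnramifiedAt v ∧ r.HasFrobCharpolyAt v (arithFrobPolyOfSatake ι v.residueCard n α))
    {τ : FramedGaloisRep K (PadicAlgCl ℓ) 1} {x : Fin n → PadicAlgCl ℓ} (hx0 : x ≠ 0)
    (hx : ∀ g : absoluteGaloisGroup K,
      r.toGaloisRep g x = ((Matrix.GeneralLinearGroup.det (τ g) : (PadicAlgCl ℓ)ˣ) : PadicAlgCl ℓ) • x)
    {χ : HeckeCharacter K} {v : HeightOneSpectrum (𝓞 K)}
    (hτ : τ.HasFrobCharpolyAt v (X - C (ι.symm (χ.valueAtUniformizer v)⁻¹)))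
    {α : Multiset ℂ} (hα : π.HasSatakeParamAt v α) (hvℓ : ((ℓ : ℕ) : 𝓞 K) ∉ v.asIdeal) :
    ∃ a ∈ α, χ.valueAtUniformizer v = ((Real.sqrt (v.residueCard : ℝ) : ℝ) : ℂ) ^ (n - 1) * a := by
  obtain ⟨𝔓, h𝔓⟩ := HeightOneSpectrum.primesAbove_nonempty v
  obtain ⟨σ, hσ⟩ := HeightOneSpectrum.exists_isArithFrobAt_of_mem_primesAbove_holds h𝔓
  obtain ⟨a, ha, hdet⟩ :=
    (stableLine_isUnramifiedAt_and_det_eq π ι r hr hx0 hx hα hvℓ).2 𝔓 h𝔓 σ hσ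
  refine ⟨a, ha, ?_⟩
  have hch := hτ 𝔓 h𝔓 σ hσ
  rw [FramedRep.charpoly_eq_X_sub_C_det_of_rank_one_bh, sub_right_inj, Polynomial.C_inj, hdet] at hch
  have h2 := ι.symm.injective hch
  rw [inv_inj] at h2
  exact h2.symm

/-- **BH §3.2.1, the passage to the automorphic side, for `n = 3`.**  If `r : Γ_K →ₜ* GL_3(ℚ̄_ℓ)`
has the unramified compatibility of lang.S27 with `π`, `τ` is the character on an `r`-stable line
and `χ` is an algebraic Hecke character with `τ(Frob_v) = ι⁻¹(χ(ϖ_v))⁻¹` at almost all `v` (the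
conclusion of BH Thm. 1.1 for `τ`), then the ALGEBRAIC Hecke character `μ = χ ‖·‖`
(`HeckeCharacter.normCharacter`; algebraic by `isAlgebraic_normCharacter`, `IsAlgebraic.mul`)
satisfies `μ(ϖ_v) ∈ α_v` — its value at `v` is one of the three Satake eigenvalues of `π` at `v` —
at all but finitely many `v` (`χ(ϖ_v) = q_v a`, `‖ϖ_v‖ = q_v⁻¹`).  This is the content of
"(Alt) and the local-global compatibility (lg)" in the printed proof: the Galois representation is
eliminated, and what remains is a cuspidal `π` on `GL_3` one of whose Satake eigenvalues is,
place by place, the value of one fixed algebraic Hecke character. [cite: BockleHui2025, §3.2.1] -/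
theorem exists_algebraic_valueAtUniformizer_mem_satake_of_stableLine
    {hcpt₃ : isCompact_glFiniteIntegralLevel 3 K}
    (π : AutomorphicRepData (AutomorphyDatum.gl 3 K hcpt₃)) (ι : PadicAlgCl ℓ ≃+* ℂ)
    (r : FramedGaloisRep K (PadicAlgCl ℓ) 3)
    (hr : ∀ (v : HeightOneSpectrum (𝓞 K)) (α : Multiset ℂ), π.HasSatakeParamAt v α →
      ((ℓ : ℕ) : 𝓞 K) ∉ v.asIdeal →
        r.IsUnramifiedAt v ∧ r.HasFrobCharpolyAt v (arithFrobPolyOfSatake ι v.residueCard 3 α))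
    {τ : FramedGaloisRep K (PadicAlgCl ℓ) 1} {x : Fin 3 → PadicAlgCl ℓ} (hx0 : x ≠ 0)
    (hx : ∀ g : absoluteGaloisGroup K,
      r.toGaloisRep g x = ((Matrix.GeneralLinearGroup.det (τ g) : (PadicAlgCl ℓ)ˣ) : PadicAlgCl ℓ) • x)
    {χ : HeckeCharacter K} (hχalg : χ.IsAlgebraic)
    (hχ : ∀ᶠ v : HeightOneSpectrum (𝓞 K) in cofinite, χ.IsUnramifiedAt v ∧ τ.IsUnramifiedAt v ∧
      τ.HasFrobCharpolyAt v (X - C (ι.symm (χ.valueAtUniformizer v)⁻¹))) :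
    ∃ μ : HeckeCharacter K, μ.IsAlgebraic ∧
      ∀ᶠ v : HeightOneSpectrum (𝓞 K) in cofinite, μ.IsUnramifiedAt v ∧
        ∀ α : Multiset ℂ, π.HasSatakeParamAt v α → μ.valueAtUniformizer v ∈ α := by
  refine ⟨χ * HeckeCharacter.normCharacter K, hχalg.mul HeckeCharacter.isAlgebraic_normCharacter,
    ?_⟩
  filter_upwards [hχ, eventually_natCast_notMem_asIdeal₃ K ℓ] with v hv hvℓ
  refine ⟨hv.1.mul_bh (HeckeCharacter.isUnramifiedAt_normCharacter v), fun α hα => ?_⟩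
  obtain ⟨a, ha, he⟩ :=
    exists_mem_satake_valueAtUniformizer_eq_of_stableLine π ι r hr hx0 hx hv.2.2 hα hvℓ
  have hsq2 : ((Real.sqrt (v.residueCard : ℝ) : ℝ) : ℂ) ^ (3 - 1) = (v.residueCard : ℂ) := by
    rw [show (3 - 1 : ℕ) = 2 from rfl, ← Complex.ofReal_pow, Real.sq_sqrt (Nat.cast_nonneg _),
      Complex.ofReal_natCast]
  have hq0 : (v.residueCard : ℂ) ≠ 0 := by
    exact_mod_cast (lt_trans zero_lt_one v.one_lt_residueCard).ne'
  rw [HeckeCharacter.valueAtUniformizer_mul_bh, HeckeCharacter.valueAtUniformizer_normCharacter,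
    he, hsq2, mul_comm, ← mul_assoc, inv_mul_cancel₀ hq0, one_mul]
  exact ha

end StableLineHecke

/-! ### BH §3.2.1, the case "`det(σ_λ)·τ_λ^{-2}` is trivial": essential self-duality at Satake
level -/

section SelfDual

/-- **Multiset algebra of the case `det σ_λ = τ_λ²`.**  If `α` has three elements, one of which is
`m ≠ 0`, and `∏ α = m³`, then `{a⁻¹ : a ∈ α} = {m⁻² a : a ∈ α}`: writing `α = {m, b, c}` one has
`b c = m²`, so `b⁻¹ = m⁻² c`, `c⁻¹ = m⁻² b`, `m⁻¹ = m⁻² m`.  (BH §3.2.1: "Suppose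
`det(σ_λ)·τ_λ^{-2}` is trivial. Then `ρ_λ ⊗ τ_λ^{-1}` is self-dual", read on Frobenius
eigenvalues.) [cite: BockleHui2025, §3.2.1] -/
theorem map_inv_eq_map_mul_of_prod_eq_cube {α : Multiset ℂ} (h3 : Multiset.card α = 3) {m : ℂ}
    (hm : m ≠ 0) (hmem : m ∈ α) (hprod : α.prod = m ^ 3) :
    α.map (·⁻¹) = α.map (fun a => (m ^ 2)⁻¹ * a) := by
  obtain ⟨β, rfl⟩ := Multiset.exists_cons_of_mem hmem
  rw [Multiset.card_cons] at h3
  obtain ⟨b, c, rfl⟩ := Multiset.card_eq_two.1 (by omega : Multiset.card β = 2)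
  have hbc : b * c = m ^ 2 := by
    have h : m * (b * c) = m * m ^ 2 := by
      rw [Multiset.prod_cons, Multiset.insert_eq_cons, Multiset.prod_cons,
        Multiset.prod_singleton] at hprod
      rw [hprod]
      ring
    exact mul_left_cancel₀ hm h
  have hb : b ≠ 0 := by
    rintro rfl
    rw [zero_mul] at hbc
    exact pow_ne_zero 2 hm hbc.symm
  have hc : c ≠ 0 := by
    rintro rfl
    rw [mul_zero] at hbc
    exact pow_ne_zero 2 hm hbc.symm
  have hb' : b⁻¹ = (m ^ 2)⁻¹ * c := by
    rw [← hbc, mul_inv, mul_assoc, inv_mul_cancel₀ hc, mul_one]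
  have hc' : c⁻¹ = (m ^ 2)⁻¹ * b := by
    rw [← hbc, mul_inv, mul_comm b⁻¹, mul_assoc, inv_mul_cancel₀ hb, mul_one]
  have hm' : m⁻¹ = (m ^ 2)⁻¹ * m := by
    field_simp
  simp only [Multiset.insert_eq_cons, Multiset.map_cons, Multiset.map_singleton]
  rw [hb', hc', hm']
  congr 1
  exact Multiset.pair_comm _ _

variable {K : Type} [Field K] [NumberField K] {hcpt : isCompact_glFiniteIntegralLevel 3 K}

/-- **BH §3.2.1, the case `det(σ_λ) τ_λ^{-2} = 1`: `π` is essentially self-dual.**  Let `π` be an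
automorphic representation of `GL_3(𝔸_K)` and `μ` a Hecke character whose value `μ(ϖ_v)` is a
Satake eigenvalue of `π` at almost every `v` (the automorphic shadow of `ρ_λ = σ_λ ⊕ τ_λ`,
`exists_algebraic_valueAtUniformizer_mem_satake_of_stableLine`).  If moreover
`∏ α_v = μ(ϖ_v)³` at almost every `v` (the Satake-level form of "`det(σ_λ)·τ_λ^{-2}` is trivial",
i.e. `det ρ_λ = τ_λ³`), then `π` is essentially self-dual at Satake level with `η = μ⁻²`:
`{a⁻¹ : a ∈ α_v} = {η(ϖ_v) a : a ∈ α_v}` at almost every `v` ("Then `ρ_λ ⊗ τ_λ^{-1}` is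
self-dual. … `π` is essentially self-dual"; read off eigenvalue by eigenvalue, so that no
multiplicity-one theorem is needed for this rendering). [cite: BockleHui2025, §3.2.1] -/
theorem exists_essSelfDual_satake_of_prod_eq_cube
    (π : AutomorphicRepData (AutomorphyDatum.gl 3 K hcpt)) (μ : HeckeCharacter K)
    (hμ : ∀ᶠ v : HeightOneSpectrum (𝓞 K) in cofinite, μ.IsUnramifiedAt v ∧
      ∀ α : Multiset ℂ, π.HasSatakeParamAt v α → μ.valueAtUniformizer v ∈ α)
    (h1 : ∀ᶠ v : HeightOneSpectrum (𝓞 K) in cofinite,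
      ∀ α : Multiset ℂ, π.HasSatakeParamAt v α → α.prod = μ.valueAtUniformizer v ^ 3) :
    ∃ η : HeckeCharacter K, ∀ᶠ v : HeightOneSpectrum (𝓞 K) in cofinite,
      ∀ α : Multiset ℂ, π.HasSatakeParamAt v α →
        η.IsUnramifiedAt v ∧ α.map (fun a => a⁻¹) = α.map (fun a => η.valueAtUniformizer v * a) := by
  refine ⟨(μ * μ)⁻¹, ?_⟩
  filter_upwards [hμ, h1] with v hv h1v α hα
  refine ⟨(hv.1.mul_bh hv.1).inv_bh, ?_⟩
  rw [HeckeCharacter.valueAtUniformizer_inv, HeckeCharacter.valueAtUniformizer_mul_bh, ← pow_two]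
  exact map_inv_eq_map_mul_of_prod_eq_cube hα.card_eq
    (HeckeCharacter.valueAtUniformizer_ne_zero_bh μ v) (hv.2 α hα) (h1v α hα)

end SelfDual

/-! ### Assembly: `hL` from the analytic case at Satake level, and Theorem 1.2 from four inputs
about `π` and one about weak abelian direct summands -/

section Assembly

/-- **The `L`-function dichotomy `hL` of `reducible_forces_essSelfDual_gl3_totallyReal_of` from its
analytic case stated about `π` alone.**  Granting (`hB`) that for `K` totally real, `π` regular
algebraic cuspidal on `GL_3(𝔸_K)` and an ALGEBRAIC Hecke character `μ` whose value `μ(ϖ_v)` is a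
Satake eigenvalue of `π_v` at almost every `v`, one has `∏ α_v = μ(ϖ_v)³` at almost every `v` —
the printed "Suppose `det(σ_λ)·τ_λ^{-2}` is non-trivial. … the right-hand side of (L-eq) at `s = 1`
belongs to `ℂ` … `L^{S'}(1, s)` has a simple pole at `s = 1` and `L^{S'}(Alt²(π) ⊗ ψ₁, s)` is
non-zero at `s = 1` … We get a contradiction", whose conclusion at Satake level is exactly the
triviality of `ψ₃ ↔ det ρ_λ · τ_λ^{-3}` at almost all places — the dichotomy follows: the Hecke
character `χ` of the stable line yields `μ = χ‖·‖` with `μ(ϖ_v) ∈ α_v`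
(`exists_algebraic_valueAtUniformizer_mem_satake_of_stableLine`), `hB` gives `∏ α_v = μ(ϖ_v)³`, and
`exists_essSelfDual_satake_of_prod_eq_cube` gives essential self-duality with `η = μ⁻²`.
[cite: BockleHui2025, §3.2.1] -/
theorem lDichotomy_gl3_totallyReal_of_satakeLevel
    (hB : ∀ (K : Type) [Field K] [NumberField K], IsTotallyReal K →
      ∀ (hcpt : isCompact_glFiniteIntegralLevel 3 K) (π : CuspidalAutomorphicRepData 3 K hcpt),
        π.1.IsRegularAlgebraic → ∀ μ : HeckeCharacter K, μ.IsAlgebraic →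
        (∀ᶠ v : HeightOneSpectrum (𝓞 K) in cofinite, μ.IsUnramifiedAt v ∧
          ∀ α : Multiset ℂ, π.1.HasSatakeParamAt v α → μ.valueAtUniformizer v ∈ α) →
        ∀ᶠ v : HeightOneSpectrum (𝓞 K) in cofinite,
          ∀ α : Multiset ℂ, π.1.HasSatakeParamAt v α → α.prod = μ.valueAtUniformizer v ^ 3) :
    ∀ (K : Type) [Field K] [NumberField K], IsTotallyReal K →
      ∀ (hcpt : isCompact_glFiniteIntegralLevel 3 K) (π : CuspidalAutomorphicRepData 3 K hcpt),
        π.1.IsRegularAlgebraic → ∀ (ℓ : ℕ) [Fact ℓ.Prime] (ι : PadicAlgCl ℓ ≃+* ℂ)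
        (r : FramedGaloisRep K (PadicAlgCl ℓ) 3), r.toGaloisRep.IsSemisimple →
        (∀ (v : HeightOneSpectrum (𝓞 K)) (α : Multiset ℂ), π.1.HasSatakeParamAt v α →
            ((ℓ : ℕ) : 𝓞 K) ∉ v.asIdeal →
              r.IsUnramifiedAt v ∧ r.HasFrobCharpolyAt v (arithFrobPolyOfSatake ι v.residueCard 3 α)) →
        ∀ (τ : FramedGaloisRep K (PadicAlgCl ℓ) 1),
        (∃ x : Fin 3 → PadicAlgCl ℓ, x ≠ 0 ∧ ∀ g : absoluteGaloisGroup K,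
          r.toGaloisRep g x =
            ((Matrix.GeneralLinearGroup.det (τ g) : (PadicAlgCl ℓ)ˣ) : PadicAlgCl ℓ) • x) →
        (∃ χ : HeckeCharacter K, χ.IsAlgebraic ∧
          ∀ᶠ v : HeightOneSpectrum (𝓞 K) in cofinite, χ.IsUnramifiedAt v ∧ τ.IsUnramifiedAt v ∧
            τ.HasFrobCharpolyAt v (X - C (ι.symm (χ.valueAtUniformizer v)⁻¹))) →
        ∃ η : HeckeCharacter K, ∀ᶠ v : HeightOneSpectrum (𝓞 K) in cofinite,
          ∀ α : Multiset ℂ, π.1.HasSatakeParamAt v α →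
            η.IsUnramifiedAt v ∧ α.map (fun a => a⁻¹) = α.map (fun a => η.valueAtUniformizer v * a) := by
  intro K _ _ hK hcpt π hπ ℓ _ ι r _ hr τ ⟨x, hx0, hx⟩ ⟨χ, hχalg, hχ⟩
  obtain ⟨μ, hμalg, hμ⟩ :=
    exists_algebraic_valueAtUniformizer_mem_satake_of_stableLine π.1 ι r hr hx0 hx hχalg hχ
  exact exists_essSelfDual_satake_of_prod_eq_cube π.1 μ hμ (hB K hK hcpt π hπ μ hμalg hμ)

/-- **Böckle–Hui, Theorem 1.2, from Theorem 1.1 and three statements about `π`.**  Granting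
* (`hBH`) Böckle–Hui's Theorem 1.1 in the tree's form
  (`GaloisRepresentations.exists_heckeCharacter_of_weaklyDivides`),
* (`hCar`) C-arithmeticity of regular algebraic cuspidal `π` on `GL_3` over totally real fields
  (BH §3.1 after Clozel 1990, Thm. 3.13 and Buzzard–Gee: the unramified Hecke eigenvalues lie in a
  number field `E ⊆ ℂ` off a finite set of places),
* (`hB`) the analytic case of §3.2.1 at Satake level (an algebraic Hecke character `μ` with
  `μ(ϖ_v) ∈ α_v` a.e. forces `∏ α_v = μ(ϖ_v)³` a.e.; in print: the pole of `L^{S'}(1, s)`, the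
  non-vanishing of `L^{S'}(Alt²(π) ⊗ ψ₁, 1)` [Sh97], and the finiteness of
  `L^{S'}(π ⊗ ψ₂, 1) L^{S'}(ψ₃, 1)` for `ψ₃ ≠ 1`), and
* (`hHui`) the last sentence, "But in this case, `ρ_λ` is irreducible (see [Hu23a])",
the named fact `isIrreducible_galoisRep_gl3_totallyReal` holds: `hrat` of
`reducible_forces_essSelfDual_gl3_totallyReal_of` is `rational_gl3_totallyReal_of_heckeEigenvalue_mem hCar`,
`hL` is `lDichotomy_gl3_totallyReal_of_satakeLevel hB`, and the conclusion is
`isIrreducible_galoisRep_gl3_totallyReal_of_reducibleForcesEssSelfDual_of_hui`.  None of the four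
inputs is proved in the tree (module docstring); this theorem fixes their Lean phrasing — all but
`hBH` now concern `π` alone — and checks the logic of the printed proof.
[cite: BockleHui2025, Theorem 1.2, §3.1 and §3.2.1] -/
theorem isIrreducible_galoisRep_gl3_totallyReal_of_weaklyDivides_of_arithmetic_of_satakeLevel_of_hui
    (hBH : GaloisRepresentations.exists_heckeCharacter_of_weaklyDivides)
    (hCar : ∀ {K : Type} [Field K] [NumberField K] (hcpt : isCompact_glFiniteIntegralLevel 3 K),
      IsTotallyReal K → ∀ (π : CuspidalAutomorphicRepData 3 K hcpt), π.1.IsRegularAlgebraic →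
      ∃ E : Subfield ℂ, FiniteDimensional ℚ E ∧
        ∀ᶠ v : HeightOneSpectrum (𝓞 K) in cofinite, ∀ α : Multiset ℂ,
          π.1.HasSatakeParamAt v α → ∀ i ≤ 3, heckeEigenvalueOf 3 v α i ∈ E)
    (hB : ∀ (K : Type) [Field K] [NumberField K], IsTotallyReal K →
      ∀ (hcpt : isCompact_glFiniteIntegralLevel 3 K) (π : CuspidalAutomorphicRepData 3 K hcpt),
        π.1.IsRegularAlgebraic → ∀ μ : HeckeCharacter K, μ.IsAlgebraic →
        (∀ᶠ v : HeightOneSpectrum (𝓞 K) in cofinite, μ.IsUnramifiedAt v ∧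
          ∀ α : Multiset ℂ, π.1.HasSatakeParamAt v α → μ.valueAtUniformizer v ∈ α) →
        ∀ᶠ v : HeightOneSpectrum (𝓞 K) in cofinite,
          ∀ α : Multiset ℂ, π.1.HasSatakeParamAt v α → α.prod = μ.valueAtUniformizer v ^ 3)
    (hHui : ∀ (K : Type) [Field K] [NumberField K], IsTotallyReal K →
      ∀ (hcpt : isCompact_glFiniteIntegralLevel 3 K) (π : CuspidalAutomorphicRepData 3 K hcpt),
        π.1.IsRegularAlgebraic →
        (∃ η : HeckeCharacter K, ∀ᶠ v : HeightOneSpectrum (𝓞 K) in cofinite,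
          ∀ α : Multiset ℂ, π.1.HasSatakeParamAt v α →
            η.IsUnramifiedAt v ∧ α.map (fun a => a⁻¹) = α.map (fun a => η.valueAtUniformizer v * a)) →
        ∀ (ℓ : ℕ) [Fact ℓ.Prime] (ι : PadicAlgCl ℓ ≃+* ℂ)
        (r : FramedGaloisRep K (PadicAlgCl ℓ) 3), r.toGaloisRep.IsSemisimple →
        (∀ (v : HeightOneSpectrum (𝓞 K)) (α : Multiset ℂ), π.1.HasSatakeParamAt v α →
            ((ℓ : ℕ) : 𝓞 K) ∉ v.asIdeal →
              r.IsUnramifiedAt v ∧ r.HasFrobCharpolyAt v (arithFrobPolyOfSatake ι v.residueCard 3 α)) →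
        r.toGaloisRep.IsIrreducible) :
    isIrreducible_galoisRep_gl3_totallyReal :=
  isIrreducible_galoisRep_gl3_totallyReal_of_reducibleForcesEssSelfDual_of_hui
    (fun _ _ _ hK hcpt π hπ ℓ _ ι r hss hr hirr =>
      reducible_forces_essSelfDual_gl3_totallyReal_of hBH
        (rational_gl3_totallyReal_of_heckeEigenvalue_mem hCar)
        (lDichotomy_gl3_totallyReal_of_satakeLevel hB) hK hcpt π hπ ℓ ι r hss hr hirr)
    hHui

end Assembly

end Literature.NumberTheory.Automorphic
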